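import Summits.Ventures.Crystal3D.Theorems.StickyWulffConstantTextureLiminfTexShadowLevelReachMirrorCut
import HarnessLib

/-!
# IMMEDIATE EVENTS of the (β) mirror launches are END PAIRS: a non-moving mirror ball has two payers and is the cross target of its reading
# (lane T, crux `TextureLiminfV5`, stmt-Ventures-23912, registered stub `stub_terraceCensus`; (β) terrace census, LevelReach — immediate events)

HONEST FRAMING. Venture `Summits/Ventures/Crystal3D` (cell `crystal3d-full`), route `route-Ventures-StickyWulffConstant`, helper `--supports` the law-v5
crux `TextureLiminfV5` (stmt-Ventures-23912), lane T, mechanism (β) (HOME/wall-p1-g22/BETA-CUT-g22.md §5(2)).  Census-free, certificate-free;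
`KissingGap δ`, `KissingClassification δ` BY NAME exactly as in lane F's `certified_end_two_payers`; nothing about energies; F-C1 not moved.

THE POINT.  `mirrorLaunch_endPairs_cut` (…LevelReachMirrorCut p741815) launches the (β) lines at the mirror balls `q = r + A′w` of located readings `r` of
`(A, n)` THAT MOVE STRAIGHT (`hmov`).  A reading whose mirror ball does not move is an IMMEDIATE EVENT; this file shows it costs the census nothing:
* `two_payers_of_certified_not_isMoving` — lane F's `certified_end_two_payers` without the state bookkeeping: a ball `b ∈ X` with an occupied `G`-face
  and predecessor `b − G w ∈ X` that is NOT moving along `G w` has `≤ 11` contacts or two distinct contact neighbours with `≤ 11` contacts;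
* `mirrorLaunch_two_payers` — hence a non-moving mirror ball `r + A′w` has two payers;
* **`isEndMove_mirrorLaunch`** — and `(r + A′w, r)` IS an end pair of lane F's automaton: the reading `r`, in the class (`A`-dozen, direction `−A w`,
  which crosses `n` upward), CROSSES at `r` onto `r + A′w` in the mirrored class `(A ≫ R_n = A′, A′w)`, whose state is not moving — `IsEndMove X ver A (−A w) r (r + A′w)`.
So every located reading contributes either a launched line (census) or a typed end pair in the class `(A, −Aw)` of the reading frame (certificate),
or its mirror ball CROSSES at once (a located reading of another plane at `q` — the cut / band terms).
WHAT THIS IS NOT: any count; F-C1 not moved.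
-/

noncomputable section

namespace Summit.Ventures.Crystal3D.Cruxes.TextureLiminf.TexShadow

open Finset Summit.Ventures.Crystal3D Summit.Ventures.Crystal3D.Theorems
open scoped InnerProductSpace

variable {X : Finset (EuclideanSpace ℝ (Fin 3))}

open scoped Classical in
/-- **A certified non-moving state has two payers** (lane F's `certified_end_two_payers`, state bookkeeping discharged): `b ∈ X` with an occupied
`G`-face triple and predecessor `b − G w ∈ X` (`w` a slot), not moving along `G w` under version `ver`, has at most eleven contacts or two distinct contact
neighbours with at most eleven contacts each. -/
theorem two_payers_of_certified_not_isMoving (ver : WordVersion) {δ : ℝ} (hg : KissingGap δ) (hc : KissingClassification δ)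
    (hX : ∀ p ∈ X, ∀ q ∈ X, p ≠ q → 1 ≤ dist p q) (G : EuclideanSpace ℝ (Fin 3) ≃ₗᵢ[ℝ] EuclideanSpace ℝ (Fin 3))
    {w b : EuclideanSpace ℝ (Fin 3)} (hw : w ∈ fccSlots) (hb : b ∈ X)
    (hface : ∃ a ∈ fccSlots, ∃ a' ∈ fccSlots, ∃ a'' ∈ fccSlots,
      ⟪a, a'⟫_ℝ = 1 / 2 ∧ ⟪a, a''⟫_ℝ = 1 / 2 ∧ ⟪a', a''⟫_ℝ = 1 / 2 ∧ b + G a ∈ X ∧ b + G a' ∈ X ∧ b + G a'' ∈ X)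
    (hpred : b - G w ∈ X) (hnm : ¬ IsMoving X ver G (G w) b) :
    (X.filter fun q => dist b q = 1).card ≤ 11 ∨
      ∃ z₁ ∈ X, ∃ z₂ ∈ X, z₁ ≠ z₂ ∧ dist b z₁ = 1 ∧ dist b z₂ = 1 ∧
        (X.filter fun q => dist z₁ q = 1).card ≤ 11 ∧ (X.filter fun q => dist z₂ q = 1).card ≤ 11 := by
  -- one class: the frame `G` with direction `G w`
  set F : Unit → (EuclideanSpace ℝ (Fin 3) ≃ₗᵢ[ℝ] EuclideanSpace ℝ (Fin 3)) := fun _ => G with hF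
  set d : Unit → EuclideanSpace ℝ (Fin 3) := fun _ => G w with hd
  set W : Finset (EuclideanSpace ℝ (Fin 3) × Unit) := (X.filter fun c =>
      (∃ a ∈ fccSlots, ∃ a' ∈ fccSlots, ∃ a'' ∈ fccSlots,
        ⟪a, a'⟫_ℝ = 1 / 2 ∧ ⟪a, a''⟫_ℝ = 1 / 2 ∧ ⟪a', a''⟫_ℝ = 1 / 2 ∧ c + G a ∈ X ∧ c + G a' ∈ X ∧ c + G a'' ∈ X) ∧
      c - G w ∈ X).image fun c => (c, ()) with hW
  have hWmem : ∀ v : EuclideanSpace ℝ (Fin 3) × Unit, v ∈ W ↔ (v.1 ∈ X ∧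
      (∃ a ∈ fccSlots, ∃ a' ∈ fccSlots, ∃ a'' ∈ fccSlots,
        ⟪a, a'⟫_ℝ = 1 / 2 ∧ ⟪a, a''⟫_ℝ = 1 / 2 ∧ ⟪a', a''⟫_ℝ = 1 / 2 ∧
        v.1 + F v.2 a ∈ X ∧ v.1 + F v.2 a' ∈ X ∧ v.1 + F v.2 a'' ∈ X) ∧
      v.1 - d v.2 ∈ X) := by
    rintro ⟨c, t⟩
    rw [hW, mem_image]
    constructor
    · rintro ⟨c', hc', he⟩
      obtain ⟨rfl, -⟩ := Prod.mk.inj he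
      exact ⟨(mem_filter.1 hc').1, (mem_filter.1 hc').2.1, (mem_filter.1 hc').2.2⟩
    · rintro ⟨hcX, hf, hp⟩
      exact ⟨c, mem_filter.2 ⟨hcX, hf, hp⟩, rfl⟩
  have hdslot : ∀ κ : Unit, ∃ u ∈ fccSlots, d κ = F κ u := fun _ => ⟨w, hw, rfl⟩
  have he : ((b, ()) : EuclideanSpace ℝ (Fin 3) × Unit) ∈ W := (hWmem _).2 ⟨hb, hface, hpred⟩
  obtain ⟨hnf, hnt⟩ := not_full_not_twin_of_not_isMoving hnm
  exact certified_end_two_payers (e := (b, ())) hg hc hX hdslot hWmem he hnf hnt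

variable (A A' : EuclideanSpace ℝ (Fin 3) ≃ₗᵢ[ℝ] EuclideanSpace ℝ (Fin 3)) {n r w : EuclideanSpace ℝ (Fin 3)}

/-- **A non-moving mirror ball has two payers.**  `r` a located twin reading of `(A, n)`, `w` a near slot, `A′` the mirror frame; if the mirror ball
`r + A′w` does not move along `A′w`, it has at most eleven contacts or two distinct contact neighbours with at most eleven contacts each. -/
theorem mirrorLaunch_two_payers (ver : WordVersion) {δ : ℝ} (hg : KissingGap δ) (hc : KissingClassification δ)
    (hX : ∀ p ∈ X, ∀ q ∈ X, p ≠ q → 1 ≤ dist p q) (hrX : r ∈ X) (hr : IsTwinReading X A n r) (hw : w ∈ fccSlots) (hwn : ⟪A w, n⟫_ℝ < 0)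
    (hA' : ∀ x, A' x = A x - (2 * ⟪A x, n⟫_ℝ) • n) (hnm : ¬ IsMoving X ver A' (A' w) (r + A' w)) :
    (X.filter fun q => dist (r + A' w) q = 1).card ≤ 11 ∨
      ∃ z₁ ∈ X, ∃ z₂ ∈ X, z₁ ≠ z₂ ∧ dist (r + A' w) z₁ = 1 ∧ dist (r + A' w) z₂ = 1 ∧
        (X.filter fun q => dist z₁ q = 1).card ≤ 11 ∧ (X.filter fun q => dist z₂ q = 1).card ≤ 11 :=
  two_payers_of_certified_not_isMoving ver hg hc hX A' hw (mirrorLaunch_mem A A' hr hw hwn hA') (mirrorLaunch_face A A' hrX hr hw hwn hA')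
    (by rw [add_sub_cancel_right]; exact hrX) hnm

/-- **The immediate event is an END PAIR of the automaton**: the reading `r`, as a state of the class (`A`, direction `−A w`) — which crosses `n` upward —
moves by a CROSS along `n` onto its mirror ball `r + A′w` in the mirrored class (`A ≫ R_n = A′`, direction `A′w`); if that state does not move,
`IsEndMove X ver A (−A w) r (r + A′w)`. -/
theorem isEndMove_mirrorLaunch (ver : WordVersion) (hr : IsTwinReading X A n r) (hw : w ∈ fccSlots) (hwn : ⟪A w, n⟫_ℝ < 0)
    (hA' : ∀ x, A' x = A x - (2 * ⟪A x, n⟫_ℝ) • n) (hnm : ¬ IsMoving X ver A' (A' w) (r + A' w)) :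
    IsEndMove X ver A (-A w) r (r + A' w) := by
  have hn1 : ‖n‖ = 1 := hr.1.1
  have hwn' := inner_eq_neg_of_near A hr.1 hw hwn
  have hdn : ⟪-A w, n⟫_ℝ = Real.sqrt (2 / 3) := by rw [inner_neg_left, hwn', neg_neg]
  -- the mirrored frame `A ≫ R_n` is `A′`
  have hG : A.trans (ℝ ∙ n)ᗮ.reflection = A' :=
    LinearIsometryEquiv.ext fun x => by rw [LinearIsometryEquiv.trans_apply, reflection_unit_apply hn1, hA' x]
  have htarget : r + A' w = r - (-A w - (2 * ⟪-A w, n⟫_ℝ) • n) := by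
    rw [hA' w, inner_neg_left]; module
  refine Or.inr ⟨n, hr, hdn, htarget, ?_⟩
  rw [hG, add_sub_cancel_left]; exact hnm

/-- **Dichotomy at a located reading**, the form the assembly consumes: for each near slot `w`, EITHER the mirror ball moves (straight — it is a launch of
`mirrorLaunch_endPairs_cut` — or by a cross at once, a located reading at `r + A′w`), OR `(r + A′w, r)` is a typed end pair: contact, two payers, and
`IsEndMove` from the reading in the class `(A, −A w)`. -/
theorem mirrorLaunch_moving_or_endPair (ver : WordVersion) {δ : ℝ} (hg : KissingGap δ) (hc : KissingClassification δ)
    (hX : ∀ p ∈ X, ∀ q ∈ X, p ≠ q → 1 ≤ dist p q) (hrX : r ∈ X) (hr : IsTwinReading X A n r) (hw : w ∈ fccSlots) (hwn : ⟪A w, n⟫_ℝ < 0)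
    (hA' : ∀ x, A' x = A x - (2 * ⟪A x, n⟫_ℝ) • n) :
    IsMoving X ver A' (A' w) (r + A' w) ∨
      (r + A' w ∈ X ∧ dist (r + A' w) r = 1 ∧ IsEndMove X ver A (-A w) r (r + A' w) ∧
        ((X.filter fun q => dist (r + A' w) q = 1).card ≤ 11 ∨
          ∃ z₁ ∈ X, ∃ z₂ ∈ X, z₁ ≠ z₂ ∧ dist (r + A' w) z₁ = 1 ∧ dist (r + A' w) z₂ = 1 ∧
            (X.filter fun q => dist z₁ q = 1).card ≤ 11 ∧ (X.filter fun q => dist z₂ q = 1).card ≤ 11)) := by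
  by_cases hm : IsMoving X ver A' (A' w) (r + A' w)
  · exact Or.inl hm
  · refine Or.inr ⟨mirrorLaunch_mem A A' hr hw hwn hA', ?_, isEndMove_mirrorLaunch A A' ver hr hw hwn hA' hm,
      mirrorLaunch_two_payers A A' ver hg hc hX hrX hr hw hwn hA' hm⟩
    rw [dist_eq_norm, add_sub_cancel_left, LinearIsometryEquiv.norm_map, norm_eq_one_of_mem_fccSlots hw]

end Summit.Ventures.Crystal3D.Cruxes.TextureLiminf.TexShadow

end
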